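import Summits.QuantumFields.QCD.Theses.PauliWegnerSea
import Summits.QuantumFields.QCD.Theorems.MobilityGap.Negative.LowerPin
import Summits.QuantumFields.QCD.Theorems.PauliWegnerSeaChiralOneScaleTrajectoryTransferAE
import Summits.QuantumFields.QCD.Theorems.ChiralOneScaleTrajectory.Negative.CriticalMassLimsup
import Summits.QuantumFields.QCD.Theorems.ChiralOneScaleTrajectory.Negative.UpShift
import Summits.QuantumFields.QCD.Theorems.ChiralOneScaleTrajectory.Negative.VolumeGrowth

/-!
# Line `chern-plateau-pin` — skeleton for crux `PauliWegnerSea.ChiralOneScaleTrajectory`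
# (stmt-QuantumFields-17512), planner-cruxplan-stmt-QuantumFields-17512-chern-plateau-pin-0, 2026-08-17

IDEA (card `Cruxes/ChiralOneScaleTrajectory/Ideas/chern-plateau-pin.md`, triage r1-1 fail / r1-2 pass /
r1-3 pass).  The Hermitian Wilson–Dirac family `m₀ ↦ H_W(m₀,·) = Γ₅ D_W(·, m₀, 1)` under the sea measure at
large `β` is a four-dimensional quantum-Hall plateau family: its (non-commutative) second Chern number is
`0` on the whole half-line `m₀ > 0` (deterministic gap, PROVED `Ideator2.positiveMassPlateau_holds`) and
`∓N_f` per colour on the weak-coupling `m₀ = −1` plateau (free value: corner formula `freeWilsonChern (-1) = -1`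
below; HJL/Neuberger gap on admissible fields PROVED `Ideator2.weakFieldPlateauGap`), so between the two
plateaus the coupled (operator, measure) family has a SINGULAR bare mass `m⋆(β) ∈ (−1, 0]`
(Halperin / Prodan–Leung–Bellissard): the Wilson chiral critical line EXISTS, located by an integer
jump and by no estimate at the light point.

WHAT THE LOCATION BUYS (answer to triage r1-1 "output consumed by no step"): an INTRINSIC critical-mass
sequence `mc(k)` turns the crux's un-splittable `∃ reg, (pin ∧ scalings ∧ ∀ m, (i) ∧ one-scale ∧ (iii) ∧ (iv))`
into SIX independent statements about ONE explicit regularisation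
`critReg N_f mc = ⟨a_k = 1/(k+1), β_k = afBeta N_f 1 a_k, L_k = (k+1)², m_crit := mc, canonical Z_m⟩`:
  A `stub_criticalLine`        — ∃ mc ≥ −1 eventually, MASSLESS AT ZERO: at renormalised mass 0 (bare mass
                                 `mc(k)` itself) every physical-rate decay certificate `C e^{−ε a_k ‖v‖}` of the
                                 phase-quenched propagator is violated on some torus `S ≥ L_k`, eventually in `k`
                                 — the plateau transition's output in crux currency (sign-free, junk-free);
  B `stub_oneScaleAboveLine`    — the crux's one-scale clause along `mc(k) + a_k m/Z_m(k)`, every `m > 0`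
                                 (localised side of the transition, at the log shell);
  C `stub_lightHadronsAboveLine`— clause (iii) LOWER along it (quarks not lattice-heavy above the line);
  D `stub_signCoherenceAboveLine`— clause (iv) at the scheme volume along it;
  D′ `stub_pionSignKernelAboveLine`— the pion sign kernel at the scheme volume along it (Sign₃; free at N_f = 2);
  E `stub_goldstoneWindow`      — massless at 0 ⇒ for every ε some m > 0 has its charged-pion second moment
                                 ACROSS the scheme torus above every rate-ε certificate (one point per k):
                                 continuity of the gap in the quark mass at the located point.
`ChiralOneScaleTrajectory_of : A → B → C → D → D′ → E → ChiralOneScaleTrajectory` is proved below (scalings,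
clause (i) from `mc ≥ −1`, superlogarithmic volume of the canonical data, and the landed Wick–γ₅ transfer
`chiralityTransfer_ae` fed by E + D′ at `S = n = L_k`); `ChiralOneScaleTrajectory_of_stubs` applies it to the stubs.

DISPROOF USED (`Cruxes/ChiralOneScaleTrajectory/Disproof.lean`, cdisprove FINAL, verdict resists; no
`_false_without_` theorem exists): §2 `withoutLowerAndPin_holds` — the two honesty pins (iii) LOWER and the pin
are carried by C and E, nothing else is claimed hard for free; §4 `not_packageForcesChirality_of` /
`Negative/UpShift` — the line's `m_crit` is NOT up-shift invariant (A's masslessness at ZERO fails after any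
shift `+a_k M₀/Z_m`), which is exactly how B–E may be `∀ mc`-statements without forcing chirality above a
threshold; `Negative/CriticalMassLimsup` — A forces `mc(k) ≤ o(a_k)`-light bare masses, consistent;
`Negative/VolumeGrowth` — superlog volume is built into `critReg` (`a_k L_k/(1+|log a_k|) = (k+1)/(1+log(k+1))
→ ∞`, `critReg_superlog`); `Negative/ShellDepth` — B keeps `∀ q ∃ K₀ s` in the crux's order; §4
`body_of_bodyMinusPin_of_blowup` — the pin is produced through the charged-pion chain at DEGENERATE tuples
(`det² ≥ 0` at `N_f = 2`; the kernel D′ at `N_f = 3`), not through a sign blow-up.  The three Negative modules are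
imported above (scratch compatibility check).
-/

noncomputable section

namespace Summit.QuantumFields.QCD.Cruxes.ChiralOneScaleTrajectory.ChernPlateauPin

open scoped BigOperators Topology
open MeasureTheory Filter Set
open Literature.MathematicalPhysics.QuantumFieldTheory Literature.MathematicalPhysics.QuantumLattice
  Literature.Probability.LatticeModels
open Summit.QuantumFields.QCD.Theorems.MobilityGapNegative
open Summit.QuantumFields.QCD.Cruxes.ChiralOneScaleTrajectory.GoldstoneWitness (chiralityTransfer_ae)
open Summit.QuantumFields.QCD.Theses.PauliWegnerSea (ChiralOneScaleTrajectory)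

variable {Nf : ℕ}

/-! ### §0 The explicit regularisation family and the location predicate -/

variable (Nf) in
/-- **The regularisation pinned to a critical-mass sequence `mc`**: the canonical asymptotically free
data of the tree (`a_k = 1/(k+1)`, `β_k = afBeta N_f 1 a_k`, `L_k = (k+1)²`, `Z_m(k) = (log a_k⁻²)^{γ₀/2β₀}`)
with `m_crit := mc` — the ONLY free datum of the line is the located critical line. -/
def critReg (mc : ℕ → ℝ) : QCDRegularisation Nf :=
  { QCDRegularisation.canonicalAF Nf with mcrit := mc }

@[simp] theorem critReg_mcrit (mc : ℕ → ℝ) (k : ℕ) : (critReg Nf mc).mcrit k = mc k := rfl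

theorem critReg_a (mc : ℕ → ℝ) (k : ℕ) : (critReg Nf mc).a k = ((k : ℝ) + 1)⁻¹ := rfl

theorem critReg_L (mc : ℕ → ℝ) (k : ℕ) : (critReg Nf mc).L k = (k + 1) ^ 2 := rfl

/-- `critReg` has leading-log mass scaling (it shares `Z_m`, `a` with `canonicalAF`). [folklore] -/
theorem critReg_hasMassScaling (mc : ℕ → ℝ) : (critReg Nf mc).HasMassScaling :=
  QCDRegularisation.canonicalAF_hasMassScaling

/-- `critReg` scales asymptotically (`β_k = afBeta N_f 1 a_k` by construction). [folklore] -/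
theorem critReg_hasAsymptoticScaling (mc : ℕ → ℝ) :
    ((critReg Nf mc).scheme 0 0 0).HasAsymptoticScaling := by
  refine ⟨1, one_pos, tendsto_const_nhds.congr' (Eventually.of_forall fun k => ?_)⟩
  show (0 : ℝ) = afBeta Nf 1 ((SpeciesScheme.zero Unit).a k) - afBeta Nf 1 ((SpeciesScheme.zero Unit).a k)
  rw [sub_self]

/-- `a_k ≤ 1` along `critReg`. [folklore] -/
theorem critReg_a_le_one (mc : ℕ → ℝ) (k : ℕ) : (critReg Nf mc).a k ≤ 1 := by
  rw [critReg_a]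
  exact inv_le_one_of_one_le₀ (by linarith [(Nat.cast_nonneg k : (0 : ℝ) ≤ k)])

/-- Pure analysis: `x / (1 + log x) → ∞`. [folklore] -/
theorem tendsto_div_one_add_log_atTop : Tendsto (fun x : ℝ => x / (1 + Real.log x)) atTop atTop := by
  -- `(1 + log x)/x → 0⁺`, invert
  have h0 : Tendsto (fun x : ℝ => (1 + Real.log x) / x) atTop (𝓝 0) := by
    have h1 : Tendsto (fun x : ℝ => x⁻¹) atTop (𝓝 0) := tendsto_inv_atTop_zero
    have h2 := Real.isLittleO_log_id_atTop.tendsto_div_nhds_zero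
    have : (fun x : ℝ => (1 + Real.log x) / x) = fun x => x⁻¹ + Real.log x / id x := by
      funext x; simp only [id]; ring
    rw [this]
    simpa using h1.add h2
  have hpos : ∀ᶠ x : ℝ in atTop, 0 < (1 + Real.log x) / x := by
    filter_upwards [eventually_ge_atTop (1 : ℝ)] with x hx
    have : 0 ≤ Real.log x := Real.log_nonneg hx
    positivity
  have h0' : Tendsto (fun x : ℝ => (1 + Real.log x) / x) atTop (𝓝[>] 0) :=
    tendsto_nhdsWithin_iff.2 ⟨h0, hpos⟩
  have hinv := h0'.inv_tendsto_nhdsGT_zero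
  refine hinv.congr' ?_
  filter_upwards [eventually_ge_atTop (1 : ℝ)] with x hx
  simp only [Pi.inv_apply, inv_div]

/-- **Superlogarithmic physical volume of the canonical data**: `a_k L_k / (1 + |log a_k|) =
(k+1)/(1 + log(k+1)) → ∞` (necessary by `Negative/VolumeGrowth`, used by the pin chain). [folklore] -/
theorem critReg_superlog (mc : ℕ → ℝ) :
    Tendsto (fun k => (critReg Nf mc).a k * (critReg Nf mc).L k / (1 + |Real.log ((critReg Nf mc).a k)|))
      atTop atTop := by
  have hx : Tendsto (fun k : ℕ => (k : ℝ) + 1) atTop atTop :=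
    tendsto_natCast_atTop_atTop.atTop_add tendsto_const_nhds
  refine (tendsto_div_one_add_log_atTop.comp hx).congr fun k => ?_
  have hk : (0 : ℝ) < (k : ℝ) + 1 := by positivity
  simp only [Function.comp_apply, critReg_a, critReg_L, Nat.cast_pow, Nat.cast_add, Nat.cast_one,
    Real.log_inv, abs_neg, abs_of_nonneg (Real.log_nonneg (by linarith : (1 : ℝ) ≤ (k : ℝ) + 1))]
  field_simp

/-- **MASSLESS AT ZERO** (the location certificate, in crux currency). Along `reg`, at renormalised mass
`0` — i.e. at the bare mass `m_crit(k)` itself, degenerate over flavours — the phase-quenched fractional moment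
`fm` of the quark propagator violates EVERY physical-rate decay certificate FAR OUT: for all `ε > 0` and all `C`,
eventually in `k`, some torus `S ≥ L_k` and some site `v ∈ box S` at sup-distance `‖v‖ ≥ L_k` (physical distance
`≥ a_k L_k → ∞`; this floor excludes local-moment blow-ups at `v = 0`) carry `C e^{−ε a_k ‖v‖} < fm`.  Sign-free
(`|det|`-weights), junk-free (positive denominators, bounded integrands), and NOT invariant under the up-shift
`m_crit ↦ m_crit + a_k M₀/Z_m` — it pins the flavour-blind offset of `m_crit` to the chiral point. -/
def MasslessAtZero (reg : QCDRegularisation Nf) : Prop :=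
  ∃ s : ℝ, 0 < s ∧ s < 1 ∧ ∀ ε : ℝ, 0 < ε → ∀ C : ℝ, ∀ᶠ k in atTop, ∃ S : ℕ, reg.L k ≤ S ∧
    ∃ (f : Fin Nf) (v : Site 4), v ∈ box 4 S ∧ (reg.L k : ℝ) ≤ ‖v‖ ∧
      C * Real.exp (-(ε * (reg.a k * ‖v‖))) < fm Nf (reg.β k) (fun _ : Fin Nf => reg.mcrit k) S f v s

variable (Nf) in
/-- **`mc` lies on the chiral critical line** of the canonical AF sequence: `mc(k) ≥ −1` eventually (Lüscher's
branch, clause (i)) and `critReg N_f mc` is massless at zero.  Hypothesis of stubs B–E, conclusion of stub A. -/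
def OnCriticalLine (mc : ℕ → ℝ) : Prop :=
  (∀ᶠ k in atTop, -1 ≤ mc k) ∧ MasslessAtZero (critReg Nf mc)

/-- **The charged-pion DIAGONAL pin** (GMOR-lite, one point per `k`): for every rate `ε` some renormalised mass
`m > 0` has, for every `C`, eventually in `k`, the phase-quenched SECOND moment of the flavour-`f` propagator
block from `0` to `L_k e₀` on the scheme torus (side `2L_k+1`) above `C e^{−ε a_k L_k}` — at `N_f = 2` this IS
the charged-pion correlator across the torus (landed `pionCorr_eq_neg_signedQuotient`).  Text of the quotient
= the `Q2` of landed `signedPin_of_lowerPins_signCoh`. -/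
def PionDiagonalPin (reg : QCDRegularisation Nf) (f : Fin Nf) : Prop :=
  ∀ ε : ℝ, 0 < ε → ∃ m : ℝ, 0 < m ∧ ∀ C : ℝ, ∀ᶠ k in atTop,
    C * Real.exp (-(ε * (reg.a k * reg.L k))) < (∫ U : GaugeConfig 4 (2 * reg.L k + 1) (Matrix.specialUnitaryGroup (Fin 3) ℂ), ‖(diracMatrix U fun _ : Fin Nf => reg.mcrit k + reg.a k * m / reg.Zm k).det‖ * (∑ a : Fin 3, ∑ i : Fin 4, ∑ b : Fin 3, ∑ j : Fin 4, ‖(diracMatrix U fun _ : Fin Nf => reg.mcrit k + reg.a k * m / reg.Zm k)⁻¹ (quarkEquiv (f, (Torus.proj (2 * reg.L k + 1) 0, a, i))) (quarkEquiv (f, (Torus.proj (2 * reg.L k + 1) (Pi.single 0 (reg.L k : ℤ)), b, j)))‖ ^ (2 : ℕ)) ∂(wilsonMeasure (fundamentalRep (Fin 3)) (reg.β k))) / (∫ U : GaugeConfig 4 (2 * reg.L k + 1) (Matrix.specialUnitaryGroup (Fin 3) ℂ), ‖(diracMatrix U fun _ : Fin Nf => reg.mcrit k + reg.a k * m / reg.Zm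 k).det‖ ∂(wilsonMeasure (fundamentalRep (Fin 3)) (reg.β k)))

/-- **The pion SIGN KERNEL at the scheme volume** (Sign₃ of the dead line, verbatim the `hSC` hypothesis of landed
`signedPin_of_lowerPins_signCoh`): some `θ > 0` such that for every `m > 0`, eventually in `k`, the SIGNED
second-moment quotient at `S = n = L_k` has norm at least `θ` times the phase-quenched one.  Automatic at
`N_f = 2` (landed `signCoh_two`, `det² ≥ 0`); at `N_f = 3` it is sign coherence of `det D_W(m(k))` weighted by the
pion block, on the superlog scheme volume. -/
def PionSignKernel (reg : QCDRegularisation Nf) (f : Fin Nf) : Prop :=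
  ∃ θ : ℝ, 0 < θ ∧ ∀ m : ℝ, 0 < m → ∀ᶠ k in atTop, θ * ((∫ U : GaugeConfig 4 (2 * reg.L k + 1) (Matrix.specialUnitaryGroup (Fin 3) ℂ), ‖(diracMatrix U fun _ : Fin Nf => reg.mcrit k + reg.a k * m / reg.Zm k).det‖ * (∑ a : Fin 3, ∑ i : Fin 4, ∑ b : Fin 3, ∑ j : Fin 4, ‖(diracMatrix U fun _ : Fin Nf => reg.mcrit k + reg.a k * m / reg.Zm k)⁻¹ (quarkEquiv (f, (Torus.proj (2 * reg.L k + 1) 0, a, i))) (quarkEquiv (f, (Torus.proj (2 * reg.L k + 1) (Pi.single 0 (reg.L k : ℤ)), b, j)))‖ ^ (2 : ℕ)) ∂(wilsonMeasure (fundamentalRep (Fin 3)) (reg.β k))) / (∫ U : GaugeConfig 4 (2 * reg.L k + 1) (Matrix.specialUnitaryGroup (Fin 3) ℂ), ‖(diracMatrix U fun _ : Fin Nf => reg.mcrit k + reg.a k * m / reg.Zm k).det‖ ∂(wilsonMeasure (fundamentalRep (Fin 3)) (reg.β k)))) ≤ ‖(∫ U : GaugeConfig 4 (2 * reg.L k +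 1) (Matrix.specialUnitaryGroup (Fin 3) ℂ), (diracMatrix U fun _ : Fin Nf => reg.mcrit k + reg.a k * m / reg.Zm k).det * ((∑ a : Fin 3, ∑ i : Fin 4, ∑ b : Fin 3, ∑ j : Fin 4, ‖(diracMatrix U fun _ : Fin Nf => reg.mcrit k + reg.a k * m / reg.Zm k)⁻¹ (quarkEquiv (f, (Torus.proj (2 * reg.L k + 1) 0, a, i))) (quarkEquiv (f, (Torus.proj (2 * reg.L k + 1) (Pi.single 0 (reg.L k : ℤ)), b, j)))‖ ^ (2 : ℕ) : ℝ) : ℂ) ∂(wilsonMeasure (fundamentalRep (Fin 3)) (reg.β k))) / (∫ U : GaugeConfig 4 (2 * reg.L k + 1) (Matrix.specialUnitaryGroup (Fin 3) ℂ), (diracMatrix U fun _ : Fin Nf => reg.mcrit k + reg.a k * m / reg.Zm k).det ∂(wilsonMeasure (fundamentalRep (Fin 3)) (reg.β k)))‖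

/-! ### §1 The plateau route to stub A, typed (documentation `def`s, NOT registered stubs)

How stub A is meant to be proved (card chern-plateau-pin; these Props only document the route and give
`--supports` targets; none is used by the composition):
* `FMSingularAt N_f β s m⋆` — local-uniform fractional-moment localisation FAILS at bare mass `m⋆` at coupling
  `β`: in every bare-mass neighbourhood of `m⋆` every LATTICE-rate certificate `(C, μ)` is violated on some
  torus.  The delocalisation branch of the transition (Golterman–Shamir: mobility edge of `H_W` at zero).
* `PlateauTransitionFM` — the fixed-coupling plateau theorem, delocalisation form: `∃ β₀ ∀ β ≥ β₀ ∃ m⋆ ∈ (−1,0]`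
  FM-singular (answers triage: `∃ β₀`, not `∀ β ≥ 0`).  Route: `C₂ = 0` on `m₀ > 0` (PROVED
  `Ideator2.positiveMassPlateau_holds`), `C₂(β, −1) = N_f · freeWilsonChern (−1) ≠ 0` for `β ≥ β₀`
  (WeakCouplingPlateau: Lifshitz-tail FM localisation of `H_W(−1)` under the sea measure — HJL gap
  `Ideator2.weakFieldPlateauGap` PROVED + chessboard rarity of rough plaquettes + the route's Wegner estimate
  K1/K3), Prodan–Leung–Bellissard quantisation/homotopy (doi:10.1088/1751-8113/46/48/485202, Thm 2 / Prop. 6) for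
  the joint (operator, measure) family.  HONEST GAPS: (a) with an `m₀`-DEPENDENT sea measure the homotopy
  argument also admits a measure-singular exit (first-order coexistence, Sharpe–Singleton `c₂ < 0`): then
  `PlateauTransitionFM` is FALSE at fixed `β` while stub A still holds iff the minimal pion mass vanishes in
  physical units (`m_π,min ~ aΛ²`); (b) quantisation needs ergodic sea states or equal Chern integers across
  coexisting phases.  This is why A, not `PlateauTransitionFM`, is the registered stub.
* `SelectionLemma` — Halperin's selection, PROVABLE NOW (pure analysis: continuity of `fm` in the bare mass at
  fixed `k, S, v` forces the violating tori to be large): FM-singular points `m⋆_k ∈ (−1, 0]` at `β_k` for all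
  large `k` ⇒ some `mc` on the critical line.  First `--supports` target of the line.
* `freeWilsonChern` — the free plateau values (corner formula of the Brillouin-zone winding of the `r = 1` Wilson
  symbol `d(p) = (sin p_μ; m₀ + Σ_μ(1 − cos p_μ))`; triage toys r1-1/r1-2 confirm `0, −1, +3, −3, +1, 0`). -/

/-- FM-singular bare mass at coupling `β` (delocalisation at zero energy of `H_W(m⋆)` in fractional-moment form). -/
def FMSingularAt (Nf : ℕ) (β s m : ℝ) : Prop :=
  ∀ η : ℝ, 0 < η → ∀ C μ : ℝ, 0 < μ → ∃ m₀ : ℝ, |m₀ - m| < η ∧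
    ∃ (S : ℕ) (f : Fin Nf) (v : Site 4), v ∈ box 4 S ∧
      C * Real.exp (-(μ * ‖v‖)) < fm Nf β (fun _ : Fin Nf => m₀) S f v s

/-- The plateau theorem, delocalisation form (fixed coupling; conjectural — see the honest gaps above). -/
def PlateauTransitionFM : Prop :=
  ∀ Nf : ℕ, Nf = 2 ∨ Nf = 3 → ∃ s β₀ : ℝ, 0 < s ∧ s < 1 ∧ ∀ β : ℝ, β₀ ≤ β →
    ∃ m : ℝ, -1 < m ∧ m ≤ 0 ∧ FMSingularAt Nf β s m

/-- Halperin's selection along the canonical AF couplings `β_k = afBeta N_f 1 (1/(k+1))` (provable now). -/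
def SelectionLemma : Prop :=
  ∀ Nf : ℕ, Nf = 2 ∨ Nf = 3 → ∀ s : ℝ, 0 < s → s < 1 →
    (∀ᶠ k in atTop, ∃ m : ℝ, -1 < m ∧ m ≤ 0 ∧
      FMSingularAt Nf ((QCDRegularisation.canonicalAF Nf).β k) s m) →
    ∃ mc : ℕ → ℝ, OnCriticalLine Nf mc

/-- `SelectionLemma` and `PlateauTransitionFM` give stub A once `β_k → ∞` (recorded shape only). -/
def PlateauRouteToA : Prop :=
  PlateauTransitionFM → SelectionLemma → ∀ Nf : ℕ, Nf = 2 ∨ Nf = 3 → ∃ mc : ℕ → ℝ, OnCriticalLine Nf mc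

/-- **Free plateau values** (corner formula for the winding of the free `r = 1` Wilson symbol over the Brillouin
4-torus: corners with `j` momenta equal to `π` have multiplicity `C(4,j)`, chirality `(−1)^j`, mass `m₀ + 2j`). -/
def freeWilsonChern (m₀ : ℝ) : ℝ :=
  (1 / 2 : ℝ) * ∑ j ∈ Finset.range 5, (Nat.choose 4 j : ℝ) * (-1) ^ j * Real.sign (m₀ + 2 * j)

/-- The positive-mass plateau is trivial: `freeWilsonChern 1 = 0`. -/
example : freeWilsonChern 1 = 0 := by
  simp only [freeWilsonChern, Finset.sum_range_succ, Finset.sum_range_zero]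
  norm_num [Real.sign_of_pos, Nat.choose]

/-- The first doubler window carries winding `−1` per colour and flavour: `freeWilsonChern (−1) = −1`. -/
example : freeWilsonChern (-1) = -1 := by
  simp only [freeWilsonChern, Finset.sum_range_succ, Finset.sum_range_zero]
  norm_num [Real.sign_of_pos, Real.sign_of_neg, Nat.choose]

/-! ### §2 The registered stubs -/

/-- **Stub A · the Wilson chiral critical line exists (plateau transition, crux currency).**  For
`N_f ∈ {2,3}` there is a bare-mass sequence `mc(k) ≥ −1` (eventually) along the canonical AF couplings such
that `critReg N_f mc` is MASSLESS AT ZERO.  Plateau route: §1 (`PlateauTransitionFM` + `SelectionLemma` in the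
delocalisation branch; in the first-order branch the measure-singular point is massless at physical rate iff
the minimal pion mass vanishes in physical units).  Why it might fail: a strongly first-order chiral transition
surviving the continuum limit (minimal pion mass `≥ ε₀ Λ`) — then NO Wilson regularisation is chiral and the crux
is false with it.  Size XL (new theorem: PLB for a Gibbs-weighted covariant family; definition request: the
non-commutative `C₂` of a finite-range covariant family over a translation-invariant gauge measure). -/
theorem stub_criticalLine :
    ∀ Nf : ℕ, Nf = 2 ∨ Nf = 3 → ∃ mc : ℕ → ℝ, OnCriticalLine Nf mc := by
  sorry

/-- **Stub B · one-scale localisation above the critical line** (the crux's one-scale clause, verbatim, for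
`critReg N_f mc` at every positive tuple): for every `q` some log-scale shell `ℓ₀ ≤ L_k`, `ℓ₀ a_k ≤ K₀(1+|log a_k|)`,
carries `ℓ₀^q (1+|β_k|)^q · fm ≤ 1` on all tori `S ≥ L_k`.  The LOCALISED side of the plateau transition at
renormalised distance `m > 0` above it, with the quantitative content that the localisation length at bare offset
`a_k m/Z_m(k)` is `O(log(1/a_k)/a_k)` (critical scaling from the localised side; Lifshitz/dislocation input of
stmt-11513 + the route's FMClosureUnquenched).  Why it might fail: extended near-zero modes of `H_W` persisting a
bare distance `≫ a_k/Z_m(k)` above every massless point (Aoki finger wider than `a_k/Z_m`). Size XL. -/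
theorem stub_oneScaleAboveLine :
    ∀ Nf : ℕ, Nf = 2 ∨ Nf = 3 → ∀ mc : ℕ → ℝ, OnCriticalLine Nf mc →
      ∀ m : Fin Nf → ℝ, (∀ f, 0 < m f) →
        ∀ q : ℕ, ∃ K₀ s : ℝ, 0 < s ∧ s < 1 ∧ ∀ᶠ k in atTop, ∃ ℓ₀ : ℕ, 1 ≤ ℓ₀ ∧ ℓ₀ ≤ (critReg Nf mc).L k ∧
          (ℓ₀ : ℝ) * (critReg Nf mc).a k ≤ K₀ * (1 + |Real.log ((critReg Nf mc).a k)|) ∧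
            ∀ S : ℕ, (critReg Nf mc).L k ≤ S → ∀ (f : Fin Nf) (v : Site 4), v ∈ box 4 S → ‖v‖ = (ℓ₀ : ℝ) →
              (ℓ₀ : ℝ) ^ q * (1 + |(critReg Nf mc).β k|) ^ q *
                fm Nf ((critReg Nf mc).β k) (bare (critReg Nf mc) m k) S f v s ≤ 1 := by
  sorry

/-- **Stub C · light hadrons above the critical line** (clause (iii) LOWER, verbatim, for `critReg N_f mc` at every
positive tuple): `c₀ e^{-(C₁ a_k n + p log(n+1))} ≤ fm(n e₀)` for all `S ≥ L_k`, `n ≤ S`, eventually — the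
phase-quenched propagator does not decay at lattice rate, uniformly in the volume.  The certified honesty pin of
the crux (Disproof §2) and the death point of line `Sketch`; here a standalone `∀`-statement about ONE intrinsic
trajectory (refutable on its own: if the located line is not the chiral line, quarks above it are lattice-heavy
and C fails).  Why it might fail: it is a volume-uniform LOWER bound for the interacting weak-coupling measure at
its own critical line — constructive lattice QCD in the chiral regime; no printed proof.  Size: open-problem. -/
theorem stub_lightHadronsAboveLine :
    ∀ Nf : ℕ, Nf = 2 ∨ Nf = 3 → ∀ mc : ℕ → ℝ, OnCriticalLine Nf mc →
      ∀ m : Fin Nf → ℝ, (∀ f, 0 < m f) → Lower (critReg Nf mc) m := by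
  sorry

/-- **Stub D · sign coherence of the sea above the critical line, at the scheme volume** (clause (iv) verbatim for
`critReg N_f mc` at every positive tuple): on the superlogarithmic scheme torus `(2L_k+1)⁴`,
`|∫ Π_f det D_W(m_f(k)) dμ_W| ≥ ½ ∫ |Π_f det| dμ_W` eventually.  Free at positive bare masses (landed
`sign_of_eventually_pos`) and at `N_f = 2` DEGENERATE tuples (`det² ≥ 0`); contentful at `N_f = 2` non-degenerate
tuples (the sign is the parity of the number of real `D_W`-modes in the bare window `[|m₂(k)|, |m₁(k)|)` just below
`|mc(k)|`, lead c4-0's remark) and at `N_f = 3` (dislocation density on physical four-volume `(a_k L_k)⁴ = (k+1)⁴`).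
Why it might fail: exceptional configurations (physical-branch real modes displaced by more than `a_k m/Z_m(k)`)
with probability not `o((k+1)^{-4})` per unit physical volume drive `⟨sign⟩ → 0` on the scheme torus.  Size L–XL. -/
theorem stub_signCoherenceAboveLine :
    ∀ Nf : ℕ, Nf = 2 ∨ Nf = 3 → ∀ mc : ℕ → ℝ, OnCriticalLine Nf mc →
      ∀ m : Fin Nf → ℝ, (∀ f, 0 < m f) → Sign (critReg Nf mc) m := by
  sorry

/-- **Stub D′ · the pion sign kernel above the critical line** (`PionSignKernel` for every flavour of
`critReg N_f mc`): the signed pion-weighted quotient at `S = n = L_k` keeps a fixed fraction `θ` of the phase-quenched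
one, eventually, for every `m > 0` — the ONE-volume sign input through which the honest (signed) pion correlator
inherits the diagonal pin of stub E.  At `N_f = 2` it holds with `θ = 1` (landed `signCoh_two`-type identity,
`det² = |det|²`); at `N_f = 3` it is Sign₃ of the dead line `Sketch`, now asked along an intrinsic trajectory.  Why
it might fail: as stub D, plus correlation between the sign of `det D_W(m(k))` and a large pion block across the
torus (the configurations that carry the long-distance propagator could be exactly the exceptional ones). Size L–XL. -/
theorem stub_pionSignKernelAboveLine :
    ∀ Nf : ℕ, Nf = 2 ∨ Nf = 3 → ∀ mc : ℕ → ℝ, OnCriticalLine Nf mc →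
      ∀ f : Fin Nf, PionSignKernel (critReg Nf mc) f := by
  sorry

/-- **Stub E · the Goldstone window (continuity of the gap in the quark mass at the located point).**  If
`critReg N_f mc` is massless at ZERO, then for every rate `ε` some POSITIVE renormalised mass `m` carries the
charged-pion diagonal pin across the scheme torus (`PionDiagonalPin`): the set of renormalised masses whose pion is
lighter than `ε` is a neighbourhood of `0` of width bounded below in `k` — GMOR-lite, ONE point per `k`, no
volume-uniformity, no all-distances (strictly less than NoCollapse of line `Sketch`).  The only stub that consumes
masslessness AT the line to produce chirality ABOVE it (triage r1-3's "relative continuity").  Why it might fail: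
the bare width of the rate-`ε` window above `mc(k)` could shrink faster than `a_k/Z_m(k)` (dimensional
transmutation with the wrong power: a fixed-`k` modulus of continuity is useless), i.e. pions at every fixed
`m > 0` lattice-heavier than `ε` although `m = 0` is massless.  Size XL (Goldstone/GMOR input). -/
theorem stub_goldstoneWindow :
    ∀ Nf : ℕ, Nf = 2 ∨ Nf = 3 → ∀ mc : ℕ → ℝ, OnCriticalLine Nf mc →
      ∀ f : Fin Nf, PionDiagonalPin (critReg Nf mc) f := by
  sorry

/-! ### §3 Composition -/

/-- Clause (i) along `critReg`: `mc(k) ≥ −1` eventually puts every positive tuple on Lüscher's branch. -/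
theorem clauseI_critReg (mc : ℕ → ℝ) (hwin : ∀ᶠ k in atTop, -1 ≤ mc k) (m : Fin Nf → ℝ)
    (hm : ∀ f, 0 < m f) : ClauseI (critReg Nf mc) m := by
  intro f
  filter_upwards [hwin] with k hk
  have hpos : 0 < (critReg Nf mc).a k * m f / (critReg Nf mc).Zm k :=
    div_pos (mul_pos ((critReg Nf mc).a_pos k) (hm f)) ((critReg Nf mc).Zm_pos k)
  show -1 < mc k + (critReg Nf mc).a k * m f / (critReg Nf mc).Zm k
  linarith

/-- **Diagonal pin + sign kernel ⇒ the signed pin consumed by `chiralityTransfer_ae`** (at `S = n = L_k`). -/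
theorem signedPin_of_diagonalPin_signKernel (reg : QCDRegularisation Nf) (f : Fin Nf)
    (hDP : PionDiagonalPin reg f) (hSK : PionSignKernel reg f) :
    ∀ ε : ℝ, 0 < ε → ∃ m : ℝ, 0 < m ∧ ∀ C : ℝ, ∃ᶠ k in atTop, ∃ S : ℕ, reg.L k ≤ S ∧ ∃ n : ℕ, n ≤ S ∧ C * Real.exp (-(ε * (reg.a k * n))) < ‖(∫ U : GaugeConfig 4 (2 * S + 1) (Matrix.specialUnitaryGroup (Fin 3) ℂ), (diracMatrix U fun _ : Fin Nf => reg.mcrit k + reg.a k * m / reg.Zm k).det * ((∑ a : Fin 3, ∑ i : Fin 4, ∑ b : Fin 3, ∑ j : Fin 4, ‖(diracMatrix U fun _ : Fin Nf => reg.mcrit k + reg.a k * m / reg.Zm k)⁻¹ (quarkEquiv (f, (Torus.proj (2 * S + 1) 0, a, i))) (quarkEquiv (f, (Torus.proj (2 * S + 1) (Pi.single 0 (n : ℤ)), b, j)))‖ ^ (2 : ℕ) : ℝ) : ℂ) ∂(wilsonMeasure (fundamentalRep (Fin 3)) (reg.β k))) / (∫ U : GaugeConfig 4 (2 * S + 1)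 (Matrix.specialUnitaryGroup (Fin 3) ℂ), (diracMatrix U fun _ : Fin Nf => reg.mcrit k + reg.a k * m / reg.Zm k).det ∂(wilsonMeasure (fundamentalRep (Fin 3)) (reg.β k)))‖ := by
  intro ε hε
  obtain ⟨θ, hθ, hcoh⟩ := hSK
  obtain ⟨m, hm, hpin⟩ := hDP ε hε
  refine ⟨m, hm, fun C => ?_⟩
  refine Eventually.frequently (((hpin (max C 0 / θ)).and (hcoh m hm)).mono fun k hk => ?_)
  obtain ⟨hlt, hcohk⟩ := hk
  refine ⟨reg.L k, le_rfl, reg.L k, le_rfl, ?_⟩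
  set Q2 : ℝ := (∫ U : GaugeConfig 4 (2 * reg.L k + 1) (Matrix.specialUnitaryGroup (Fin 3) ℂ), ‖(diracMatrix U fun _ : Fin Nf => reg.mcrit k + reg.a k * m / reg.Zm k).det‖ * (∑ a : Fin 3, ∑ i : Fin 4, ∑ b : Fin 3, ∑ j : Fin 4, ‖(diracMatrix U fun _ : Fin Nf => reg.mcrit k + reg.a k * m / reg.Zm k)⁻¹ (quarkEquiv (f, (Torus.proj (2 * reg.L k + 1) 0, a, i))) (quarkEquiv (f, (Torus.proj (2 * reg.L k + 1) (Pi.single 0 (reg.L k : ℤ)), b, j)))‖ ^ (2 : ℕ)) ∂(wilsonMeasure (fundamentalRep (Fin 3)) (reg.β k))) / (∫ U : GaugeConfig 4 (2 * reg.L k + 1) (Matrix.specialUnitaryGroup (Fin 3) ℂ), ‖(diracMatrix U fun _ : Fin Nf => reg.mcrit k + reg.a k * m / reg.Zm k).det‖ ∂(wilsonMeasure (fundamentalRep (Fin 3)) (reg.β k))) with hQ2def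
  set QS : ℂ := (∫ U : GaugeConfig 4 (2 * reg.L k + 1) (Matrix.specialUnitaryGroup (Fin 3) ℂ), (diracMatrix U fun _ : Fin Nf => reg.mcrit k + reg.a k * m / reg.Zm k).det * ((∑ a : Fin 3, ∑ i : Fin 4, ∑ b : Fin 3, ∑ j : Fin 4, ‖(diracMatrix U fun _ : Fin Nf => reg.mcrit k + reg.a k * m / reg.Zm k)⁻¹ (quarkEquiv (f, (Torus.proj (2 * reg.L k + 1) 0, a, i))) (quarkEquiv (f, (Torus.proj (2 * reg.L k + 1) (Pi.single 0 (reg.L k : ℤ)), b, j)))‖ ^ (2 : ℕ) : ℝ) : ℂ) ∂(wilsonMeasure (fundamentalRep (Fin 3)) (reg.β k))) / (∫ U : GaugeConfig 4 (2 * reg.L k + 1) (Matrix.specialUnitaryGroup (Fin 3) ℂ), (diracMatrix U fun _ : Fin Nf => reg.mcrit k + reg.a k * m / reg.Zm k).det ∂(wilsonMeasure (fundamentalRep (Fin 3)) (reg.β k))) with hQSdef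
  change max C 0 / θ * Real.exp (-(ε * (reg.a k * reg.L k))) < Q2 at hlt
  change θ * Q2 ≤ ‖QS‖ at hcohk
  change C * Real.exp (-(ε * (reg.a k * (reg.L k : ℕ)))) < ‖QS‖
  have hpos : 0 < Real.exp (-(ε * (reg.a k * reg.L k))) := Real.exp_pos _
  have h1 : C * Real.exp (-(ε * (reg.a k * reg.L k))) ≤ max C 0 * Real.exp (-(ε * (reg.a k * reg.L k))) :=
    mul_le_mul_of_nonneg_right (le_max_left _ _) hpos.le
  have h2 : max C 0 * Real.exp (-(ε * (reg.a k * reg.L k))) = θ * (max C 0 / θ * Real.exp (-(ε * (reg.a k * reg.L k)))) := by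
    field_simp
  have h3 : θ * (max C 0 / θ * Real.exp (-(ε * (reg.a k * reg.L k)))) < θ * Q2 :=
    mul_lt_mul_of_pos_left hlt hθ
  calc C * Real.exp (-(ε * (reg.a k * (reg.L k : ℕ)))) ≤ max C 0 * Real.exp (-(ε * (reg.a k * reg.L k))) := h1
    _ = θ * (max C 0 / θ * Real.exp (-(ε * (reg.a k * reg.L k)))) := h2
    _ < θ * Q2 := h3
    _ ≤ ‖QS‖ := hcohk

/-- **Composition**: the six stubs give the crux `ChiralOneScaleTrajectory` BY NAME.  Witness for
`N_f ∈ {2,3}`: `critReg N_f mc` with `mc` from stub A; scalings by construction; (i) from `mc ≥ −1`; one-scale,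
(iii), (iv) from stubs B, C, D; the pin `IsChiralAtZero` from stub E + the kernel D′ through
`signedPin_of_diagonalPin_signKernel` and the landed `chiralityTransfer_ae` (flavours `0 ≠ 1`). -/
theorem ChiralOneScaleTrajectory_of :
    (∀ Nf : ℕ, Nf = 2 ∨ Nf = 3 → ∃ mc : ℕ → ℝ, OnCriticalLine Nf mc) →
    (∀ Nf : ℕ, Nf = 2 ∨ Nf = 3 → ∀ mc : ℕ → ℝ, OnCriticalLine Nf mc →
      ∀ m : Fin Nf → ℝ, (∀ f, 0 < m f) →
        ∀ q : ℕ, ∃ K₀ s : ℝ, 0 < s ∧ s < 1 ∧ ∀ᶠ k in atTop, ∃ ℓ₀ : ℕ, 1 ≤ ℓ₀ ∧ ℓ₀ ≤ (critReg Nf mc).L k ∧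
          (ℓ₀ : ℝ) * (critReg Nf mc).a k ≤ K₀ * (1 + |Real.log ((critReg Nf mc).a k)|) ∧
            ∀ S : ℕ, (critReg Nf mc).L k ≤ S → ∀ (f : Fin Nf) (v : Site 4), v ∈ box 4 S → ‖v‖ = (ℓ₀ : ℝ) →
              (ℓ₀ : ℝ) ^ q * (1 + |(critReg Nf mc).β k|) ^ q *
                fm Nf ((critReg Nf mc).β k) (bare (critReg Nf mc) m k) S f v s ≤ 1) →
    (∀ Nf : ℕ, Nf = 2 ∨ Nf = 3 → ∀ mc : ℕ → ℝ, OnCriticalLine Nf mc →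
      ∀ m : Fin Nf → ℝ, (∀ f, 0 < m f) → Lower (critReg Nf mc) m) →
    (∀ Nf : ℕ, Nf = 2 ∨ Nf = 3 → ∀ mc : ℕ → ℝ, OnCriticalLine Nf mc →
      ∀ m : Fin Nf → ℝ, (∀ f, 0 < m f) → Sign (critReg Nf mc) m) →
    (∀ Nf : ℕ, Nf = 2 ∨ Nf = 3 → ∀ mc : ℕ → ℝ, OnCriticalLine Nf mc →
      ∀ f : Fin Nf, PionSignKernel (critReg Nf mc) f) →
    (∀ Nf : ℕ, Nf = 2 ∨ Nf = 3 → ∀ mc : ℕ → ℝ, OnCriticalLine Nf mc →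
      ∀ f : Fin Nf, PionDiagonalPin (critReg Nf mc) f) →
    Summit.QuantumFields.QCD.Theses.PauliWegnerSea.ChiralOneScaleTrajectory := by
  intro hA hB hC hD hD' hE Nf hNf
  obtain ⟨mc, hline⟩ := hA Nf hNf
  have hwin : ∀ᶠ k in atTop, -1 ≤ mc k := hline.1
  have hNf2 : 2 ≤ Nf := by rcases hNf with rfl | rfl <;> norm_num
  set reg : QCDRegularisation Nf := critReg Nf mc with hreg
  let f : Fin Nf := ⟨0, by omega⟩
  let g : Fin Nf := ⟨1, by omega⟩
  have hfg : f ≠ g := by simp [f, g, Fin.ext_iff]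
  have hvol := critReg_superlog (Nf := Nf) mc
  have hpin : reg.IsChiralAtZero :=
    chiralityTransfer_ae Nf f g hfg reg
      (signedPin_of_diagonalPin_signKernel reg f (hE Nf hNf mc hline f) (hD' Nf hNf mc hline f))
  refine ⟨reg, critReg_hasMassScaling mc, hpin, critReg_hasAsymptoticScaling mc, fun m hm => ?_⟩
  exact ⟨clauseI_critReg mc hwin m hm, hB Nf hNf mc hline m hm, hC Nf hNf mc hline m hm,
    hD Nf hNf mc hline m hm⟩

/-- The same composition applied to the registered stubs: the crux BY NAME, modulo exactly the six `stub_*`. -/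
theorem ChiralOneScaleTrajectory_of_stubs :
    Summit.QuantumFields.QCD.Theses.PauliWegnerSea.ChiralOneScaleTrajectory :=
  ChiralOneScaleTrajectory_of stub_criticalLine stub_oneScaleAboveLine stub_lightHadronsAboveLine
    stub_signCoherenceAboveLine stub_pionSignKernelAboveLine stub_goldstoneWindow

end Summit.QuantumFields.QCD.Cruxes.ChiralOneScaleTrajectory.ChernPlateauPin

end
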